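import Summits.BirchSwinnertonDyer.BirchSwinnertonDyer.Theorems.Rank2Observatory2DescKillSig3
import HarnessLib

/-!
# KERNEL-2DESC — the 2-ADIC SIGNATURE kill certificate `sig8Check` (three `ℤ₂`-roots; signatures mod 8), PART 1 of 2:
# core lemma, graded outside mismatch, binary disc walk, RATIONAL-like patterns
# (rank-2 observatory, cert-1 gen 39; design `b2b-bsdr2-cert-1/…/census/sig2split/SIG2-CENSUS.md`, `generics/sig8/README-SIG8.md`)

HONEST FRAMING: per-curve certified theorems and census instruments; no claim on BSD in rank ≥ 2.
PARTITION: none — rank ≥ 2 data (N3); no r ≤ 1 cell claimed.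

The landed signature certificate `sig3Check` (`Rank2Observatory2DescKillSig3Core` / `…Sig3`) certifies
`TwoDescKill.KillValidAt q a b c z t₁ t₂` at a prime `q` where the field cubic has three `ℤ_q`-roots from the
signatures `(v_q mod 2, Euler bit)`; it is sound at `q = 2` but blind there (the Euler bit `x^((q−1)/2) mod q` is
vacuous), and the exact 2-adic census of the split-2 residual populations (SIG2-CENSUS: 1 192 of 1 195 ODDH-S/RN
and 1 516 of 1 533 K61 'no kill' curves die at `2`) shows that the unit class MOD 8 is what kills.  This file and
PART 2 (`Rank2Observatory2DescKillSig8`) are the 2-adic twin of the landed pair, reusing its prime-generic pieces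
(`splitPow`, `rootData`, `rootOK`, `unitOK`, `root_rel`, `index_lemma`, `val_bound`, `digit_exists`) verbatim:

* the CORE LEMMA AT 2 `core8`: `2^N ∣ 2^s·u·X² − 2^j·w` with `u, w` odd and `j + 2 < N` forces `s + j` even and
  `u ≡ w (mod 8)` (odd squares are `1 mod 8`) — induction on `j` exactly as `core`;
* the GRADED OUTSIDE MISMATCH `outMis8`: for `y ≡ c (mod 2^j)` and a root `e` with `c − e = 2^dv·w`, `dv < j`,
  the unit part of `y − e` is `≡ w` modulo `2^m`, `m = min 3 (j − dv)`, and its valuation is `dv`; the test compares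
  the root's `(s mod 2, u mod 2^m)` with `(dv mod 2, w mod 2^m)` (`outMis8_sound`);
* the BINARY DISC WALK `walk8`: at a node `(c, j)` either some root mismatches on the whole disc, or BOTH digit
  children `(c, j+1)`, `(c + 2^j, j+1)` are certified — no generic-digit shortcut is possible at `2` (the unit class of
  `y − e` at an inside root depends on deeper digits), and none is needed: an off-root disc is decided as soon as every
  root is `≥ 3` levels outside (`walk8_sound`; guard `j + B + 2 < N` at every node);
* the RATIONAL-LIKE PATTERNS `notRat8`: `y = w₀/n²` with `v₂(y) = −g < 0` gives every root the signature
  `(g mod 2, (P − 2^g·e) mod 8)` for one odd `P` (`g ≥ 3`: all three equal); the certificate excludes the 16 patterns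
  `g ∈ {1,2,3,4}`, `P ∈ {1,3,5,7}` (`notRat8_spec`; used by `caseB8` of PART 2).

PART 2 holds `sig8Check`, `kill_of_walk8`, `caseB8`, `sig8Check_sound`, `killValidAt_of_sig8Check`.  The Python mirror
`generics/sig8/prod/sig8lean.py` certifies every exact 2-adic kill of both censuses (5 228 + 8 198 classes; `N ≤ 96`,
`≤ 57` walk nodes).  Sorry-free; no `native_decide`; nothing here is rank-, field- or row-format-specific.
[cite: Cassels1991LecturesEllipticCurves, §15] [cite: CremonaAlgorithms1997, §3.6]
-/

-- single-conjunct summit: `Summit.BirchSwinnertonDyer.BirchSwinnertonDyer.…` repeats the name by design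
set_option linter.dupNamespace false

namespace Summit.BirchSwinnertonDyer.BirchSwinnertonDyer.Rank2Observatory.TwoDescKill

/-! ### The core lemma at 2 -/

/-- Odd squares are `1 mod 8`. [folklore] -/
theorem sq_emod_eight_of_not_two_dvd {X : ℤ} (hX : ¬ (2 : ℤ) ∣ X) : X ^ 2 % 8 = 1 := by
  have h1 : X % 2 = 1 := Int.two_dvd_ne_zero.mp hX
  have h8 : X % 8 = 1 ∨ X % 8 = 3 ∨ X % 8 = 5 ∨ X % 8 = 7 := by omega
  rw [sq, Int.mul_emod]
  rcases h8 with h | h | h | h <;> rw [h] <;> norm_num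

/-- **Core lemma at 2.** `2^N ∣ 2^s·u·X² − 2^j·w` with `u, w` odd and `j + 2 < N` forces `s + j` even and
`u ≡ w (mod 8)`. Induction on `j` (peel one `2`, or `2 ∣ X` and peel `4`), as `core`; no valuations. [folklore] -/
theorem core8 {u w : ℤ} (hu : ¬ (2 : ℤ) ∣ u) (hw : ¬ (2 : ℤ) ∣ w) (j : ℕ) :
    ∀ (s N : ℕ) (X : ℤ), j + 2 < N → (2 : ℤ) ^ N ∣ (2 : ℤ) ^ s * u * X ^ 2 - (2 : ℤ) ^ j * w →
      (s + j) % 2 = 0 ∧ u % 8 = w % 8 := by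
  induction' j using Nat.strong_induction_on with j ih
  intro s N X hjN h
  have hpZ : Prime (2 : ℤ) := Int.prime_two
  have hq0 : (2 : ℤ) ≠ 0 := by norm_num
  have hqN : (2 : ℤ) ∣ (2 : ℤ) ^ N := dvd_pow_self _ (by omega)
  cases j with
  | zero =>
    cases s with
    | zero =>
      refine ⟨by simp, ?_⟩
      have h' : (2 : ℤ) ^ N ∣ u * X ^ 2 - w := by simpa using h
      have h8 : (8 : ℤ) ∣ u * X ^ 2 - w := by
        have h3 : (2 : ℤ) ^ 3 ∣ (2 : ℤ) ^ N := pow_dvd_pow _ (by omega)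
        have h3' := h3.trans h'
        norm_num at h3'
        exact h3'
      have hX : ¬ (2 : ℤ) ∣ X := by
        intro hX
        apply hw
        have h2 : (2 : ℤ) ∣ u * X ^ 2 := dvd_mul_of_dvd_right (dvd_pow hX two_ne_zero) u
        have h2' : (2 : ℤ) ∣ u * X ^ 2 - w := (show (2 : ℤ) ∣ 8 by norm_num).trans h8
        simpa using dvd_sub h2 h2'
      have hm : w ≡ u * X ^ 2 [ZMOD 8] := Int.modEq_iff_dvd.mpr h8
      have hx : X ^ 2 ≡ 1 [ZMOD 8] := by
        unfold Int.ModEq; rw [sq_emod_eight_of_not_two_dvd hX]; norm_num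
      have hux : u * X ^ 2 ≡ u [ZMOD 8] := by simpa using hx.mul_left u
      exact (hm.trans hux).symm
    | succ s =>
      exfalso
      apply hw
      have h' := hqN.trans h
      have h2 : (2 : ℤ) ∣ (2 : ℤ) ^ (s + 1) * u * X ^ 2 :=
        dvd_mul_of_dvd_left (dvd_mul_of_dvd_left (dvd_pow_self _ (Nat.succ_ne_zero s)) u) _
      simpa using dvd_sub h2 h'
  | succ j =>
    cases s with
    | succ s =>
      obtain ⟨N', rfl⟩ : ∃ N', N = N' + 1 := ⟨N - 1, by omega⟩
      have h' : (2 : ℤ) ^ N' ∣ (2 : ℤ) ^ s * u * X ^ 2 - (2 : ℤ) ^ j * w := by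
        have hh : (2 : ℤ) * (2 : ℤ) ^ N' ∣ (2 : ℤ) * ((2 : ℤ) ^ s * u * X ^ 2 - (2 : ℤ) ^ j * w) := by
          have e1 : (2 : ℤ) * (2 : ℤ) ^ N' = (2 : ℤ) ^ (N' + 1) := by ring
          have e2 : (2 : ℤ) * ((2 : ℤ) ^ s * u * X ^ 2 - (2 : ℤ) ^ j * w) =
              (2 : ℤ) ^ (s + 1) * u * X ^ 2 - (2 : ℤ) ^ (j + 1) * w := by ring
          rw [e1, e2]
          exact h
        exact (mul_dvd_mul_iff_left hq0).mp hh
      have := ih j (by omega) s N' X (by omega) h'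
      exact ⟨by omega, this.2⟩
    | zero =>
      -- `2 ∣ X`
      have h1 : (2 : ℤ) ∣ u * X ^ 2 := by
        have h' := hqN.trans h
        have h2 : (2 : ℤ) ∣ (2 : ℤ) ^ (j + 1) * w := dvd_mul_of_dvd_left (dvd_pow_self _ (Nat.succ_ne_zero j)) w
        simpa using dvd_add h' h2
      have hX : (2 : ℤ) ∣ X := by
        rcases hpZ.dvd_or_dvd h1 with h3 | h3
        · exact absurd h3 hu
        · exact hpZ.dvd_of_dvd_pow h3
      obtain ⟨X₁, rfl⟩ := hX
      cases j with
      | zero =>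
        exfalso
        apply hw
        obtain ⟨N', rfl⟩ : ∃ N', N = N' + 2 := ⟨N - 2, by omega⟩
        have hA : (2 : ℤ) * 2 ∣ (2 : ℤ) ^ 0 * u * ((2 : ℤ) * X₁) ^ 2 - (2 : ℤ) ^ (0 + 1) * w :=
          (show (2 : ℤ) * 2 ∣ (2 : ℤ) ^ (N' + 2) from ⟨(2 : ℤ) ^ N', by ring⟩).trans h
        have h4 : (2 : ℤ) * 2 ∣ (2 : ℤ) * w := by
          have e : (2 : ℤ) * w = (2 : ℤ) * 2 * (u * X₁ ^ 2) -
              ((2 : ℤ) ^ 0 * u * ((2 : ℤ) * X₁) ^ 2 - (2 : ℤ) ^ (0 + 1) * w) := by ring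
          rw [e]
          exact dvd_sub (dvd_mul_right _ _) hA
        exact (mul_dvd_mul_iff_left hq0).mp h4
      | succ j =>
        obtain ⟨N', rfl⟩ : ∃ N', N = N' + 2 := ⟨N - 2, by omega⟩
        have h' : (2 : ℤ) ^ N' ∣ (2 : ℤ) ^ 0 * u * X₁ ^ 2 - (2 : ℤ) ^ j * w := by
          have hh : ((2 : ℤ) * 2) * (2 : ℤ) ^ N' ∣ ((2 : ℤ) * 2) * ((2 : ℤ) ^ 0 * u * X₁ ^ 2 - (2 : ℤ) ^ j * w) := by
            have e1 : ((2 : ℤ) * 2) * (2 : ℤ) ^ N' = (2 : ℤ) ^ (N' + 2) := by ring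
            have e2 : ((2 : ℤ) * 2) * ((2 : ℤ) ^ 0 * u * X₁ ^ 2 - (2 : ℤ) ^ j * w) =
                (2 : ℤ) ^ 0 * u * ((2 : ℤ) * X₁) ^ 2 - (2 : ℤ) ^ (j + 1 + 1) * w := by ring
            rw [e1, e2]
            exact h
          exact (mul_dvd_mul_iff_left (mul_ne_zero hq0 hq0)).mp hh
        have := ih j (by omega) 0 N' X₁ (by omega) h'
        exact ⟨by omega, this.2⟩

/-! ### The certificate components at 2 -/

/-- GRADED mismatch at a root OUTSIDE the disc `c + 2^j ℤ₂`: `c − e = 2^dv·w` with `dv < j`, `w` odd; on the disc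
the valuation of `y − e` is `dv` and its unit part is `≡ w (mod 2^m)`, `m = min 3 (j − dv)`; mismatch = the root's
`s` has the other parity, or `u ≢ w (mod 2^m)`. [cite: CremonaAlgorithms1997, §3.6] -/
def outMis8 (c : ℤ) (j : ℕ) (ρ : ℤ × ℕ × ℤ) : Bool :=
  let δ := c - ρ.1
  let sp := splitPow 2 j δ
  let M : ℤ := ((2 ^ min 3 (j - sp.1) : ℕ) : ℤ)
  !decide (δ % ((2 ^ j : ℕ) : ℤ) = 0) && !decide (sp.2 % 2 = 0) &&
    (!decide (ρ.2.1 % 2 = sp.1 % 2) || !decide (ρ.2.2 % M = sp.2 % M))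

/-- **The binary disc walk** below the node `(c, j)` (disc `c + 2^j ℤ₂` of `y`), fuelled, with the precision guard
`j + B + 2 < N`: an outside mismatch, or both digit children certified. [cite: CremonaAlgorithms1997, §3.6] -/
def walk8 (L : List (ℤ × ℕ × ℤ)) (B N : ℕ) : ℕ → ℤ → ℕ → Bool
  | 0, c, j => decide (j + B + 2 < N) && L.any (outMis8 c j)
  | f + 1, c, j =>
      decide (j + B + 2 < N) &&
        (L.any (outMis8 c j) || (walk8 L B N f c (j + 1) && walk8 L B N f (c + ((2 ^ j : ℕ) : ℤ)) (j + 1)))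

/-- RATIONAL-like pattern `(g, P)` at a root: `s ≡ g (mod 2)` and `u ≡ P − 2^g·e (mod 8)` — the signature of
`y − e` for `v₂(y) = −g`, `2^g·y ≡ P`. [folklore] -/
def ratPat (g : ℕ) (P : ℤ) (ρ : ℤ × ℕ × ℤ) : Bool :=
  decide (ρ.2.1 % 2 = g % 2) && decide (ρ.2.2 % 8 = (P - ((2 ^ g : ℕ) : ℤ) * ρ.1) % 8)

/-- Not RATIONAL-like at 2: none of the 16 patterns `g ∈ {1,2,3,4}`, `P ∈ {1,3,5,7}` is matched by every root.
[folklore] -/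
def notRat8 (L : List (ℤ × ℕ × ℤ)) : Bool :=
  ([1, 2, 3, 4] : List ℕ).all fun g => ([1, 3, 5, 7] : List ℤ).all fun P => !(L.all (ratPat g P))

/-! ### Soundness of the components -/

/-- The precision guard of a certified node. [folklore] -/
theorem walk8_guard {L : List (ℤ × ℕ × ℤ)} {B N : ℕ} :
    ∀ {f : ℕ} {c : ℤ} {j : ℕ}, walk8 L B N f c j = true → j + B + 2 < N
  | 0, c, j, h => by
      simp only [walk8, Bool.and_eq_true, decide_eq_true_eq] at h; exact h.1
  | f + 1, c, j, h => by
      simp only [walk8, Bool.and_eq_true, decide_eq_true_eq] at h; exact h.1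

/-- **Graded outside mismatch is sound**: for `y ≡ c (mod 2^j)` and a root with `v₂(c − e) < j`, the relation
`2^N ∣ 2^s·u·X² − 2^K·(y − e)` (`K` even, `K ≤ B`, `j + B + 2 < N`) forces `s ≡ dv (mod 2)` and
`u ≡ w (mod 2^m)`. [cite: CremonaAlgorithms1997, §3.6] -/
theorem outMis8_sound {c : ℤ} {j : ℕ} {ρ : ℤ × ℕ × ℤ} (hρ : ¬ (2 : ℤ) ∣ ρ.2.2)
    (h : outMis8 c j ρ = true) {B N K : ℕ} (hK : K ≤ B) (hK2 : K % 2 = 0) (hj : j + B + 2 < N)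
    {y : ℤ} (hy : (2 : ℤ) ^ j ∣ y - c)
    (hX : ∃ X : ℤ, (2 : ℤ) ^ N ∣ (2 : ℤ) ^ ρ.2.1 * ρ.2.2 * X ^ 2 - (2 : ℤ) ^ K * (y - ρ.1)) : False := by
  obtain ⟨X, hX⟩ := hX
  have cast_2j : ((2 ^ j : ℕ) : ℤ) = (2 : ℤ) ^ j := by simp
  simp only [outMis8, Bool.and_eq_true, Bool.or_eq_true, Bool.not_eq_true', decide_eq_false_iff_not,
    cast_2j] at h
  obtain ⟨⟨hδ, hw⟩, hmis⟩ := h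
  have hsp : c - ρ.1 = (2 : ℤ) ^ (splitPow 2 j (c - ρ.1)).1 * (splitPow 2 j (c - ρ.1)).2 := by
    have := splitPow_spec 2 j (c - ρ.1); simpa using this
  set dv := (splitPow 2 j (c - ρ.1)).1 with hdv
  set w := (splitPow 2 j (c - ρ.1)).2 with hwdef
  have hw' : ¬ (2 : ℤ) ∣ w := fun h => hw (Int.emod_eq_zero_of_dvd h)
  have hδ' : ¬ (2 : ℤ) ^ j ∣ c - ρ.1 := fun h => hδ (Int.emod_eq_zero_of_dvd h)
  have hdvj : dv < j := by
    by_contra hle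
    push Not at hle
    exact hδ' (hsp ▸ dvd_mul_of_dvd_left (pow_dvd_pow _ hle) w)
  obtain ⟨t, ht⟩ := hy
  obtain ⟨i, hi⟩ : ∃ i, j = dv + (i + 1) := ⟨j - dv - 1, by omega⟩
  have hye : y - ρ.1 = (2 : ℤ) ^ dv * (w + (2 : ℤ) ^ (i + 1) * t) := by
    have e : y - ρ.1 = (y - c) + (c - ρ.1) := by ring
    rw [e, ht, hsp, hi, pow_add]; ring
  have hw'' : ¬ (2 : ℤ) ∣ w + (2 : ℤ) ^ (i + 1) * t := by
    intro h
    apply hw'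
    have h2 : (2 : ℤ) ∣ (2 : ℤ) ^ (i + 1) * t := dvd_mul_of_dvd_left (dvd_pow_self _ (Nat.succ_ne_zero i)) t
    simpa using dvd_sub h h2
  have hrel : (2 : ℤ) ^ N ∣ (2 : ℤ) ^ ρ.2.1 * ρ.2.2 * X ^ 2 - (2 : ℤ) ^ (K + dv) * (w + (2 : ℤ) ^ (i + 1) * t) := by
    have e : (2 : ℤ) ^ K * (y - ρ.1) = (2 : ℤ) ^ (K + dv) * (w + (2 : ℤ) ^ (i + 1) * t) := by
      rw [hye, pow_add]; ring
    rwa [e] at hX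
  have hc := core8 hρ hw'' (K + dv) ρ.2.1 N X (by omega) hrel
  rcases hmis with hpar | hcls
  · apply hpar
    have := hc.1
    omega
  · apply hcls
    -- `u ≡ w + 2^(i+1)·t ≡ w (mod 2^m)`, `m = min 3 (i + 1)`
    have hm3 : min 3 (j - dv) ≤ 3 := min_le_left _ _
    have hmi : min 3 (j - dv) ≤ i + 1 := by rw [hi]; simp
    set m := min 3 (j - dv) with hm
    have castM : ((2 ^ m : ℕ) : ℤ) = (2 : ℤ) ^ m := by simp
    rw [castM]
    have hM8 : (2 : ℤ) ^ m ∣ 8 := by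
      have : (2 : ℤ) ^ m ∣ (2 : ℤ) ^ 3 := pow_dvd_pow _ hm3
      norm_num at this
      exact this
    have hMi : (2 : ℤ) ^ m ∣ (2 : ℤ) ^ (i + 1) * t := dvd_mul_of_dvd_left (pow_dvd_pow _ hmi) t
    have e1 : ρ.2.2 % (2 : ℤ) ^ m = ρ.2.2 % 8 % (2 : ℤ) ^ m := (Int.emod_emod_of_dvd _ hM8).symm
    have e2 : w % (2 : ℤ) ^ m = (w + (2 : ℤ) ^ (i + 1) * t) % 8 % (2 : ℤ) ^ m := by
      rw [Int.emod_emod_of_dvd _ hM8]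
      obtain ⟨k, hk⟩ := hMi
      rw [hk, Int.add_mul_emod_self_left]
    rw [e1, e2, hc.2]

/-- **Walk soundness at 2**: a certified node `(c, j)` admits no `y ≡ c (mod 2^j)` with
`2^N ∣ 2^{sᵢ}·uᵢ·Xᵢ² − 2^K·(y − eᵢ)` solvable for every root (`K` even, `K ≤ B`). [cite: CremonaAlgorithms1997, §3.6] -/
theorem walk8_sound {L : List (ℤ × ℕ × ℤ)} (hL : ∀ ρ ∈ L, ¬ (2 : ℤ) ∣ ρ.2.2)
    {B N K : ℕ} (hK : K ≤ B) (hK2 : K % 2 = 0) :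
    ∀ (f : ℕ) (c : ℤ) (j : ℕ), walk8 L B N f c j = true → ∀ y : ℤ, (2 : ℤ) ^ j ∣ y - c →
      (∀ ρ ∈ L, ∃ X : ℤ, (2 : ℤ) ^ N ∣ (2 : ℤ) ^ ρ.2.1 * ρ.2.2 * X ^ 2 - (2 : ℤ) ^ K * (y - ρ.1)) → False
  | 0, c, j, h, y, hy, hX => by
      simp only [walk8, Bool.and_eq_true, decide_eq_true_eq, List.any_eq_true] at h
      obtain ⟨hj, ρ, hρ, hm⟩ := h
      exact outMis8_sound (hL ρ hρ) hm hK hK2 hj hy (hX ρ hρ)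
  | f + 1, c, j, h, y, hy, hX => by
      simp only [walk8, Bool.and_eq_true, Bool.or_eq_true, decide_eq_true_eq, List.any_eq_true] at h
      obtain ⟨hj, h⟩ := h
      rcases h with ⟨ρ, hρ, hm⟩ | ⟨h0, h1⟩
      · exact outMis8_sound (hL ρ hρ) hm hK hK2 hj hy (hX ρ hρ)
      · have cast_2j : ((2 ^ j : ℕ) : ℤ) = (2 : ℤ) ^ j := by simp
        obtain ⟨t, ht⟩ := hy
        rcases Int.emod_two_eq_zero_or_one t with h2 | h2
        · -- digit 0: `y ≡ c (mod 2^(j+1))`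
          obtain ⟨k, hk⟩ := Int.dvd_of_emod_eq_zero h2
          exact walk8_sound hL hK hK2 f c (j + 1) h0 y
            ⟨k, by rw [pow_succ]; linear_combination ht + (2 : ℤ) ^ j * hk⟩ hX
        · -- digit 1: `y ≡ c + 2^j (mod 2^(j+1))`
          obtain ⟨k, hk⟩ : (2 : ℤ) ∣ t - 1 := by omega
          rw [cast_2j] at h1
          exact walk8_sound hL hK hK2 f (c + (2 : ℤ) ^ j) (j + 1) h1 y
            ⟨k, by rw [pow_succ]; linear_combination ht + (2 : ℤ) ^ j * hk⟩ hX

/-- `notRat8` excludes every RATIONAL-like pattern. [folklore] -/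
theorem notRat8_spec {L : List (ℤ × ℕ × ℤ)} (h : notRat8 L = true) {g : ℕ} (hg : g ∈ ([1, 2, 3, 4] : List ℕ))
    {P : ℤ} (hP : P ∈ ([1, 3, 5, 7] : List ℤ)) :
    ¬ ∀ ρ ∈ L, ρ.2.1 % 2 = g % 2 ∧ ρ.2.2 % 8 = (P - (2 : ℤ) ^ g * ρ.1) % 8 := by
  intro hall
  simp only [notRat8, List.all_eq_true, Bool.not_eq_true', List.all_eq_false] at h
  obtain ⟨ρ, hρ, hne⟩ := h g hg P hP
  apply hne
  have castg : ((2 ^ g : ℕ) : ℤ) = (2 : ℤ) ^ g := by simp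
  simp only [ratPat, Bool.and_eq_true, decide_eq_true_eq, castg]
  exact hall ρ hρ

end Summit.BirchSwinnertonDyer.BirchSwinnertonDyer.Rank2Observatory.TwoDescKill
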